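import Summits.QuantumFields.YangMills.Theses.SwapTwistDeficit
import Summits.QuantumFields.YangMills.Theorems.SwapTwistDeficitEigenDataTraces
import Summits.QuantumFields.YangMills.Theorems.SwapTwistDeficitCauchySchwarzHelpers
import HarnessLib

/-!
# SwapTwistDeficit — the aside item `CauchySchwarzDoor` (stmt-QuantumFields-23319), proved

`cauchySchwarzDoor_proof : Theses.SwapTwistDeficit.CauchySchwarzDoor`: for `L ≥ 2`, `β ≥ 1` and every physical observable `O` with `|O| ≤ 1`
that is ODD under the spatial axis swap `S = (0 1)`,
`(insTrace L β O L)² ≤ 2 · Z_phys(2L) · (Z_phys(2L) − Z^S_phys(2L))`.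

Proof (D-0145 LINE g10-B of seat ym-idea-4; the planner's parity∕Cauchy–Schwarz sketch made rigorous WITHOUT a joint eigenbasis of
`(P K_β P, S)`).  Fix ONE eigen-data (`exists_eigenData`): the complete physical eigenbasis `e_k`, `λ_k = levelValue k`, `a_k = λ_k^L`,
swap overlaps `d_k = ∫ e_k (e_k ∘ S)`.  Split `e_l = e_l⁺ + e_l⁻` into swap-even and swap-odd parts and put `A_{lk} = ∫ O e_l⁺ e_k`,
`B_{lk} = ∫ O e_l⁻ e_k`, so that `insTrace(O, L) = Σ_{k,l} a_k a_l (A_{lk} + B_{lk})²` (`eigenData_insTrace`).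
* CROSS TERMS VANISH after the `k`-sum: `Σ_k a_k A_{lk} B_{lk} = ∫ (O e_l⁺) · κ^[L] (O e_l⁻) = 0` by the bilinear spectral expansion
  (`eigenData_bilinear`) — `O e_l⁺` is swap-odd, `κ^[L](O e_l⁻)` is swap-even (`transferApply_comp_configPerm`), i.e. `P₋ T^L P₊ = 0`.
* ROW AND COLUMN BESSEL BOUNDS: `Σ_k A_{lk}² ≤ ∫ (e_l⁺)² = (1 + d_l)/2` and, since also `A_{lk} = ∫ (O e_k⁻) e_l` (one change of variables),
  `Σ_l A_{lk}² ≤ (1 − d_k)/2`; symmetrically for `B` (`eigenData_bessel`).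
* Cauchy–Schwarz on `ℕ × ℕ` (discriminant form): `Σ a_k a_l A_{lk}² ≤ √(Z₊ Z₋)` and `Σ a_k a_l B_{lk}² ≤ √(Z₊ Z₋)` with
  `Z_± = Σ_k λ_k^{2L} (1 ± d_k)/2`, i.e. `Z₊ + Z₋ = Z(2L)` (`traceFormula`) and `Z₊ − Z₋ = Z^S(2L)` (`eigenData_twistTrace`).
Hence `insTrace² ≤ 4 Z₊ Z₋ = Z² − (Z^S)² ≤ 2 Z (Z − Z^S)`.

HONEST FRAMING: an M-sized ASIDE item (the bridge `SlowBitWindow ⇒ TwistDeficit`, not load-bearing for `closes`) of a DRAFT line onto the RECORD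
rung K2a; fixed-lattice transfer-matrix theory; no summit, no mass gap, nothing about infinite volume or the continuum is proved here.
References: [cite: ReedSimonIV1978, Thm. XIII.1]; [cite: MadrasSokal1988, §2]; [cite: tHooft1979Flux].
-/

set_option autoImplicit false

noncomputable section

open MeasureTheory Filter Topology Function
open Literature.MathematicalPhysics.QuantumFieldTheory
open Literature.MathematicalPhysics.QuantumLattice
open Literature.Analysis.OperatorTheory.YMMatrixModel
open scoped BigOperators

namespace Summit.QuantumFields.YangMills.Theorems.SwapTwistDeficit

open Summit.QuantumFields.YangMills.Theorems.FemtoTransferGap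
open Summit.QuantumFields.YangMills.Theorems.FemtoTransferGap.TT

/-! ## The door (helpers: `SwapTwistDeficitCauchySchwarzHelpers`, eigen-data: `SwapTwistDeficitEigenData(Traces)`) -/

set_option maxHeartbeats 1600000 in
/-- **`CauchySchwarzDoor` holds** (item stmt-QuantumFields-23319 of route `SwapTwistDeficit`): for `L ≥ 2`, `β ≥ 1` and a physical,
bounded-by-one, swap-odd observable `O`, `(insTrace L β O L)² ≤ 2 · physTrace L β (2L) · (physTrace L β (2L) − twistTrace L β (2L))`.
[cite: ReedSimonIV1978, Thm. XIII.1] [cite: MadrasSokal1988, §2] -/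
theorem cauchySchwarzDoor_proof : Summit.QuantumFields.YangMills.Theses.SwapTwistDeficit.CauchySchwarzDoor := by
  intro L _ hL β hβ O hO hOb hodd
  have hβ0 : 0 < β := zero_lt_one.trans_le hβ
  obtain ⟨ι, _, b, lam, AP, emb, e, hAP, hsa, hbAP, -, hinj, hoff, hlam, hbe, he, hon, heig, -⟩ := exists_eigenData (L := L) hβ0
  obtain ⟨M0, -, hM0⟩ := exists_abs_transferKernel_le (L := L) β
  have hSS : ∀ U : GaugeConfig 3 L FemtoTransferGap.SU2, configPerm (Equiv.swap 0 1) (configPerm (Equiv.swap 0 1) U) = U :=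
    fun U => configPerm_swap_swap U
  -- abbreviations (opaque, with defining equations)
  obtain ⟨a, ha⟩ : ∃ a : ℕ → ℝ, a = fun k => levelValue su2Rep L β k ^ L := ⟨_, rfl⟩
  obtain ⟨d, hd⟩ : ∃ d : ℕ → ℝ, d = fun k => ∫ U, e k U * e k (configPerm (Equiv.swap 0 1) U) ∂configMeasure FemtoTransferGap.SU2 L :=
    ⟨_, rfl⟩
  obtain ⟨ep, hep⟩ : ∃ ep : ℕ → GaugeConfig 3 L FemtoTransferGap.SU2 → ℝ, ep = fun l U => (e l U + e l (configPerm (Equiv.swap 0 1) U)) / 2 :=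
    ⟨_, rfl⟩
  obtain ⟨em, hem⟩ : ∃ em : ℕ → GaugeConfig 3 L FemtoTransferGap.SU2 → ℝ, em = fun l U => (e l U - e l (configPerm (Equiv.swap 0 1) U)) / 2 :=
    ⟨_, rfl⟩
  obtain ⟨f, hf⟩ : ∃ f : ℕ → GaugeConfig 3 L FemtoTransferGap.SU2 → ℝ, f = fun l U => O U * ep l U := ⟨_, rfl⟩
  obtain ⟨h, hh⟩ : ∃ h : ℕ → GaugeConfig 3 L FemtoTransferGap.SU2 → ℝ, h = fun l U => O U * em l U := ⟨_, rfl⟩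
  obtain ⟨Am, hAm⟩ : ∃ Am : ℕ → ℕ → ℝ, Am = fun l k => ∫ U, f l U * e k U ∂configMeasure FemtoTransferGap.SU2 L := ⟨_, rfl⟩
  obtain ⟨Bm, hBm⟩ : ∃ Bm : ℕ → ℕ → ℝ, Bm = fun l k => ∫ U, h l U * e k U ∂configMeasure FemtoTransferGap.SU2 L := ⟨_, rfl⟩
  have hlv0 : ∀ k, 0 < levelValue su2Rep L β k := fun k => levelValue_su2Rep_pos hβ0 k
  have ha0 : ∀ k, 0 ≤ a k := fun k => by rw [ha]; exact pow_nonneg (hlv0 k).le L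
  have hale : ∀ k, a k ≤ a 0 := fun k => by
    rw [ha]; exact pow_le_pow_left₀ (hlv0 k).le (KTRCalibration.levelValue_antitone (L := L) hβ0.le (Nat.zero_le k)) L
  -- physicality of the pieces
  have heS : ∀ l, IsPhys fun U => e l (configPerm (Equiv.swap 0 1) U) := fun l => (he l).comp_configPerm _
  have hep_phys : ∀ l, IsPhys (ep l) := fun l => by
    have h1 := ((he l).add (heS l)).smul (1 / 2 : ℝ)
    have h2 : (1 / 2 : ℝ) • ((e l) + fun U => e l (configPerm (Equiv.swap 0 1) U)) = ep l := by
      funext U; rw [hep]; simp only [Pi.smul_apply, Pi.add_apply, smul_eq_mul]; ring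
    rw [h2] at h1; exact h1
  have hem_phys : ∀ l, IsPhys (em l) := fun l => by
    have h1 := ((he l).add ((heS l).smul (-1 : ℝ))).smul (1 / 2 : ℝ)
    have h2 : (1 / 2 : ℝ) • ((e l) + (-1 : ℝ) • fun U => e l (configPerm (Equiv.swap 0 1) U)) = em l := by
      funext U; rw [hem]; simp only [Pi.smul_apply, Pi.add_apply, smul_eq_mul]; ring
    rw [h2] at h1; exact h1
  have hf_phys : ∀ l, IsPhys (f l) := fun l => by
    rw [hf]; exact IsPhys.mul_of_invariant (hep_phys l) hO.measurable hOb hO.gaugeInv hO.zeroFlux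
  have hh_phys : ∀ l, IsPhys (h l) := fun l => by
    rw [hh]; exact IsPhys.mul_of_invariant (hem_phys l) hO.measurable hOb hO.gaugeInv hO.zeroFlux
  -- parities
  have hep_even : ∀ l U, ep l (configPerm (Equiv.swap 0 1) U) = ep l U := fun l U => by rw [hep]; dsimp only; rw [hSS]; ring
  have hem_odd : ∀ l U, em l (configPerm (Equiv.swap 0 1) U) = -em l U := fun l U => by rw [hem]; dsimp only; rw [hSS]; ring
  have hf_odd : ∀ l U, f l (configPerm (Equiv.swap 0 1) U) = -f l U := fun l U => by
    rw [hf]; dsimp only; rw [hep_even, hodd U]; ring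
  have hh_even : ∀ l U, h l (configPerm (Equiv.swap 0 1) U) = h l U := fun l U => by
    rw [hh]; dsimp only; rw [hem_odd, hodd U]; ring
  have he_split : ∀ l U, e l U = ep l U + em l U := fun l U => by rw [hep, hem]; dsimp only; ring
  -- norms: `∫ e_l² = 1`, `∫ (e_l ∘ S)² = 1`, `∫ ep² = (1+d)/2`, `∫ em² = (1-d)/2`
  have hn1 : ∀ l, ∫ U, e l U * e l U ∂configMeasure FemtoTransferGap.SU2 L = 1 := fun l => by
    have := hon l l; simp only [if_true] at this; exact this
  have hn2 : ∀ l, ∫ U, e l (configPerm (Equiv.swap 0 1) U) * e l (configPerm (Equiv.swap 0 1) U) ∂configMeasure FemtoTransferGap.SU2 L = 1 :=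
    fun l => by
    have h := l2_comp_configPerm (L := L) (Equiv.swap (0 : Fin 3) 1) (e l) (e l)
    unfold l2 at h; rw [h]; exact hn1 l
  have hi11 : ∀ l, Integrable (fun U => e l U * e l U) (configMeasure FemtoTransferGap.SU2 L) := fun l => (he l).integrable_mul (he l)
  have hi12 : ∀ l, Integrable (fun U => e l U * e l (configPerm (Equiv.swap 0 1) U)) (configMeasure FemtoTransferGap.SU2 L) :=
    fun l => (he l).integrable_mul (heS l)
  have hi22 : ∀ l, Integrable (fun U => e l (configPerm (Equiv.swap 0 1) U) * e l (configPerm (Equiv.swap 0 1) U))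
      (configMeasure FemtoTransferGap.SU2 L) := fun l => (heS l).integrable_mul (heS l)
  have hdl : ∀ l, ∫ U, e l U * e l (configPerm (Equiv.swap 0 1) U) ∂configMeasure FemtoTransferGap.SU2 L = d l := fun l => by rw [hd]
  have hepn : ∀ l, ∫ U, ep l U ^ 2 ∂configMeasure FemtoTransferGap.SU2 L = (1 + d l) / 2 := fun l => by
    have h1 : (fun U => ep l U ^ 2) = fun U => (1 / 4) * (e l U * e l U) + (1 / 2) * (e l U * e l (configPerm (Equiv.swap 0 1) U)) +
        (1 / 4) * (e l (configPerm (Equiv.swap 0 1) U) * e l (configPerm (Equiv.swap 0 1) U)) := by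
      funext U; rw [hep]; dsimp only; ring
    rw [h1, integral_add, integral_add, integral_const_mul, integral_const_mul, integral_const_mul, hn1, hn2, hdl]
    · ring
    · exact (hi11 l).const_mul _
    · exact (hi12 l).const_mul _
    · exact ((hi11 l).const_mul _).add ((hi12 l).const_mul _)
    · exact (hi22 l).const_mul _
  have hemn : ∀ l, ∫ U, em l U ^ 2 ∂configMeasure FemtoTransferGap.SU2 L = (1 - d l) / 2 := fun l => by
    have h1 : (fun U => em l U ^ 2) = fun U => (1 / 4) * (e l U * e l U) + (-1 / 2) * (e l U * e l (configPerm (Equiv.swap 0 1) U)) +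
        (1 / 4) * (e l (configPerm (Equiv.swap 0 1) U) * e l (configPerm (Equiv.swap 0 1) U)) := by
      funext U; rw [hem]; dsimp only; ring
    rw [h1, integral_add, integral_add, integral_const_mul, integral_const_mul, integral_const_mul, hn1, hn2, hdl]
    · ring
    · exact (hi11 l).const_mul _
    · exact (hi12 l).const_mul _
    · exact ((hi11 l).const_mul _).add ((hi12 l).const_mul _)
    · exact (hi22 l).const_mul _
  have hd_le : ∀ l, d l ≤ 1 := fun l => by
    have h4 : 0 ≤ ∫ U, em l U ^ 2 ∂configMeasure FemtoTransferGap.SU2 L := integral_nonneg fun U => sq_nonneg _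
    rw [hemn l] at h4; linarith
  have hd_ge : ∀ l, -1 ≤ d l := fun l => by
    have h4 : 0 ≤ ∫ U, ep l U ^ 2 ∂configMeasure FemtoTransferGap.SU2 L := integral_nonneg fun U => sq_nonneg _
    rw [hepn l] at h4; linarith
  have hO2 : ∀ U, O U ^ 2 ≤ 1 := fun U => by have := hOb U; rw [abs_le] at this; nlinarith
  have hf2 : ∀ l, ∫ U, f l U ^ 2 ∂configMeasure FemtoTransferGap.SU2 L ≤ (1 + d l) / 2 := fun l => by
    rw [← hepn l]
    refine integral_mono_of_nonneg (ae_of_all _ fun U => sq_nonneg _) ((hep_phys l).integrable_sq) (ae_of_all _ fun U => ?_)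
    dsimp only; rw [hf]; dsimp only
    nlinarith [sq_nonneg (ep l U), mul_le_mul_of_nonneg_right (hO2 U) (sq_nonneg (ep l U))]
  have hh2 : ∀ l, ∫ U, h l U ^ 2 ∂configMeasure FemtoTransferGap.SU2 L ≤ (1 - d l) / 2 := fun l => by
    rw [← hemn l]
    refine integral_mono_of_nonneg (ae_of_all _ fun U => sq_nonneg _) ((hem_phys l).integrable_sq) (ae_of_all _ fun U => ?_)
    dsimp only; rw [hh]; dsimp only
    nlinarith [sq_nonneg (em l U), mul_le_mul_of_nonneg_right (hO2 U) (sq_nonneg (em l U))]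
  -- bounds for the honest test functions
  have hfm : ∀ l, Measurable (f l) := fun l => (hf_phys l).measurable
  have hhm : ∀ l, Measurable (h l) := fun l => (hh_phys l).measurable
  have hfb : ∀ l, ∃ B, ∀ U, ‖f l U‖ ≤ B := fun l => by
    obtain ⟨C, hC⟩ := (hf_phys l).bounded; exact ⟨C, fun U => by rw [Real.norm_eq_abs]; exact hC U⟩
  have hhb : ∀ l, ∃ B, ∀ U, ‖h l U‖ ≤ B := fun l => by
    obtain ⟨C, hC⟩ := (hh_phys l).bounded; exact ⟨C, fun U => by rw [Real.norm_eq_abs]; exact hC U⟩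
  choose Bf hBf using hfb
  choose Bh hBh using hhb
  -- the alternative forms `A_{lk} = ∫ h_k e_l`, `B_{lk} = ∫ f_k e_l` (one change of variables)
  have hAm_alt : ∀ l k, Am l k = ∫ U, h k U * e l U ∂configMeasure FemtoTransferGap.SU2 L := fun l k => by
    rw [hAm]; dsimp only
    rw [← sub_eq_zero, ← integral_sub ((hf_phys l).integrable_mul (he k)) ((hh_phys k).integrable_mul (he l))]
    refine integral_eq_zero_of_swap_odd _ fun U => ?_
    rw [hf, hh, hep, hem]; dsimp only
    rw [hodd U, hSS]
    ring
  have hBm_alt : ∀ l k, Bm l k = ∫ U, f k U * e l U ∂configMeasure FemtoTransferGap.SU2 L := fun l k => by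
    rw [hBm]; dsimp only
    rw [← sub_eq_zero, ← integral_sub ((hh_phys l).integrable_mul (he k)) ((hf_phys k).integrable_mul (he l))]
    refine integral_eq_zero_of_swap_odd _ fun U => ?_
    rw [hf, hh, hep, hem]; dsimp only
    rw [hodd U, hSS]
    ring
  -- Bessel: rows and columns
  have hArow : ∀ l, Summable (fun k => Am l k ^ 2) ∧ ∑' k, Am l k ^ 2 ≤ (1 + d l) / 2 := fun l => by
    obtain ⟨h1, h2⟩ := eigenData_bessel hinj hbe (hfm l) (hBf l)
    rw [hAm]; exact ⟨h1, h2.trans (hf2 l)⟩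
  have hAcol : ∀ k, Summable (fun l => Am l k ^ 2) ∧ ∑' l, Am l k ^ 2 ≤ (1 - d k) / 2 := fun k => by
    obtain ⟨h1, h2⟩ := eigenData_bessel hinj hbe (hhm k) (hBh k)
    have hfun : (fun l => Am l k ^ 2) = fun l => (∫ U, h k U * e l U ∂configMeasure FemtoTransferGap.SU2 L) ^ 2 :=
      funext fun l => by rw [hAm_alt]
    rw [hfun]; exact ⟨h1, h2.trans (hh2 k)⟩
  have hBrow : ∀ l, Summable (fun k => Bm l k ^ 2) ∧ ∑' k, Bm l k ^ 2 ≤ (1 - d l) / 2 := fun l => by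
    obtain ⟨h1, h2⟩ := eigenData_bessel hinj hbe (hhm l) (hBh l)
    rw [hBm]; exact ⟨h1, h2.trans (hh2 l)⟩
  have hBcol : ∀ k, Summable (fun l => Bm l k ^ 2) ∧ ∑' l, Bm l k ^ 2 ≤ (1 + d k) / 2 := fun k => by
    obtain ⟨h1, h2⟩ := eigenData_bessel hinj hbe (hfm k) (hBf k)
    have hfun : (fun l => Bm l k ^ 2) = fun l => (∫ U, f k U * e l U ∂configMeasure FemtoTransferGap.SU2 L) ^ 2 :=
      funext fun l => by rw [hBm_alt]
    rw [hfun]; exact ⟨h1, h2.trans (hf2 k)⟩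
  -- the cross terms vanish after the `k`-sum
  have hcross : ∀ l, HasSum (fun k => a k * Am l k * Bm l k) 0 := by
    intro l
    have h1 := eigenData_bilinear hAP hsa hbAP hinj hoff hlam hbe (hfm l) (hBf l) (hhm l) (hBh l) (show 1 ≤ L by omega)
    have hzero : ∫ U, f l U * ((fun φ : GaugeConfig 3 L FemtoTransferGap.SU2 → ℝ => fun w =>
        ∫ z, physKernel β w z * φ z ∂configMeasure FemtoTransferGap.SU2 L)^[L] (h l)) U ∂configMeasure FemtoTransferGap.SU2 L = 0 := by
      rw [(iterate_physKernelOp_eq hM0 (hh_phys l) L).1]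
      have hK : (fun φ : GaugeConfig 3 L FemtoTransferGap.SU2 → ℝ => fun w => ∫ z, transferKernel su2Rep β w z * φ z
          ∂configMeasure FemtoTransferGap.SU2 L) = transferApply (L := L) β := by
        funext φ w; rw [transferApply_apply]
      rw [hK]
      have heven : ∀ (n : ℕ) (ψ : GaugeConfig 3 L FemtoTransferGap.SU2 → ℝ), (∀ U, ψ (configPerm (Equiv.swap 0 1) U) = ψ U) →
          ∀ U, ((transferApply (L := L) β)^[n] ψ) (configPerm (Equiv.swap 0 1) U) = ((transferApply (L := L) β)^[n] ψ) U := by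
        intro n
        induction n with
        | zero => intro ψ hψ U; exact hψ U
        | succ n ih =>
          intro ψ hψ U
          rw [Function.iterate_succ_apply']
          have hfun : (fun V => (transferApply (L := L) β)^[n] ψ (configPerm (Equiv.swap 0 1) V)) = (transferApply (L := L) β)^[n] ψ :=
            funext (ih ψ hψ)
          have h2 := congrFun (transferApply_comp_configPerm β ((transferApply (L := L) β)^[n] ψ) (Equiv.swap 0 1)) U
          rw [hfun] at h2
          exact h2.symm
      refine integral_eq_zero_of_swap_odd _ fun U => ?_
      rw [hf_odd l U, heven L (h l) (hh_even l) U]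
      ring
    rw [hzero] at h1
    refine h1.congr_fun fun k => ?_
    rw [ha, hAm, hBm]
  -- the spectral sum for the two-insertion trace, split
  have hI := eigenData_insTrace hβ0 hAP hsa hbAP hinj hoff hlam hbe he hO hOb (m := L) (by omega) (by omega)
  have hsplit : ∀ k l, (∫ U, O U * e k U * e l U ∂configMeasure FemtoTransferGap.SU2 L) = Am l k + Bm l k := fun k l => by
    rw [hAm, hBm]; dsimp only
    rw [← integral_add ((hf_phys l).integrable_mul (he k)) ((hh_phys l).integrable_mul (he k))]
    refine integral_congr_ae (ae_of_all _ fun U => ?_)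
    dsimp only
    rw [hf, hh]; dsimp only; rw [he_split l U]
    ring
  obtain ⟨G1, hG1⟩ : ∃ G1 : ℕ × ℕ → ℝ, G1 = fun p => a p.2 * a p.1 * Am p.2 p.1 ^ 2 := ⟨_, rfl⟩
  obtain ⟨G2, hG2⟩ : ∃ G2 : ℕ × ℕ → ℝ, G2 = fun p => a p.2 * a p.1 * Bm p.2 p.1 ^ 2 := ⟨_, rfl⟩
  obtain ⟨X, hX⟩ : ∃ X : ℕ × ℕ → ℝ, X = fun p => a p.2 * (a p.1 * Am p.2 p.1 * Bm p.2 p.1) := ⟨_, rfl⟩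
  have hIF : HasSum (fun p => G1 p + G2 p + 2 * X p) (insTrace L β O L) := by
    refine hI.congr_fun fun p => ?_
    rw [hG1, hG2, hX, hsplit p.1 p.2, ha]; dsimp only
    rw [show 2 * L - L = L by omega]
    ring
  have hG10 : ∀ p, 0 ≤ G1 p := fun p => by rw [hG1]; exact mul_nonneg (mul_nonneg (ha0 _) (ha0 _)) (sq_nonneg _)
  have hG20 : ∀ p, 0 ≤ G2 p := fun p => by rw [hG2]; exact mul_nonneg (mul_nonneg (ha0 _) (ha0 _)) (sq_nonneg _)
  -- summability of `G1`, `G2`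
  have hZ1 : HasSum a (physTrace L β L) := by rw [ha]; exact traceFormula L β L hβ hL
  have hR1 : Summable fun l => a l * 1 := hZ1.summable.mul_right 1
  have hG1s : Summable G1 := by
    rw [hG1]
    exact summable_weighted_cols ha0 hale ha0 (fun l k => sq_nonneg (Am l k))
      (fun l => ⟨(hArow l).1, (hArow l).2.trans (by linarith [hd_le l])⟩) hR1
  have hG2s : Summable G2 := by
    rw [hG2]
    exact summable_weighted_cols ha0 hale ha0 (fun l k => sq_nonneg (Bm l k))
      (fun l => ⟨(hBrow l).1, (hBrow l).2.trans (by linarith [hd_ge l])⟩) hR1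
  -- the cross family sums to zero
  have hXs : Summable X := by
    refine Summable.of_norm_bounded ((hG1s.add hG2s).div_const 2) fun p => ?_
    rw [Real.norm_eq_abs, hX, hG1, hG2]; dsimp only
    rw [abs_mul, abs_of_nonneg (ha0 p.2)]
    have h1 : |a p.1 * Am p.2 p.1 * Bm p.2 p.1| ≤ a p.1 * ((Am p.2 p.1 ^ 2 + Bm p.2 p.1 ^ 2) / 2) := by
      rw [mul_assoc, abs_mul, abs_of_nonneg (ha0 p.1)]
      refine mul_le_mul_of_nonneg_left ?_ (ha0 p.1)
      rw [abs_le]; constructor <;> nlinarith [sq_nonneg (Am p.2 p.1 + Bm p.2 p.1), sq_nonneg (Am p.2 p.1 - Bm p.2 p.1)]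
    nlinarith [mul_le_mul_of_nonneg_left h1 (ha0 p.2), ha0 p.2, ha0 p.1]
  have hXsum : HasSum X 0 := by
    have hcol : ∀ l, HasSum (fun k => X (k, l)) 0 := fun l => by
      have h := (hcross l).mul_left (a l)
      rw [mul_zero] at h
      refine h.congr_fun fun k => ?_
      rw [hX]
    have h1 : Summable (fun p : ℕ × ℕ => X (p.2, p.1)) := (Equiv.prodComm ℕ ℕ).summable_iff.mpr hXs
    have h2 := h1.hasSum.prod_fiberwise hcol
    have h3 : ∑' p : ℕ × ℕ, X (p.2, p.1) = 0 := h2.unique hasSum_zero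
    have h4 : ∑' p, X p = 0 := by
      rw [← h3]
      exact ((Equiv.prodComm ℕ ℕ).tsum_eq X).symm
    exact h4 ▸ hXs.hasSum
  -- `I = Σ G1 + Σ G2`
  have hIeq : insTrace L β O L = ∑' p, G1 p + ∑' p, G2 p := by
    have h := (hG1s.hasSum.add hG2s.hasSum).add (hXsum.mul_left 2)
    rw [mul_zero, add_zero] at h
    exact hIF.unique h
  -- `Z₊`, `Z₋`
  have hZ2 : HasSum (fun k => a k ^ 2) (physTrace L β (2 * L)) := by
    refine (traceFormula L β (2 * L) hβ (by omega)).congr_fun fun k => ?_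
    rw [ha]; dsimp only; rw [← pow_mul, mul_comm L 2]
  have hZS : HasSum (fun k => a k ^ 2 * d k) (twistTrace L β (2 * L)) := by
    refine (eigenData_twistTrace hAP hbAP hinj hoff hlam hbe he heig (T := 2 * L) (by omega)).congr_fun fun k => ?_
    rw [ha, hd]; dsimp only; rw [← pow_mul, mul_comm L 2]
  have hZp_sum : HasSum (fun k => a k ^ 2 * ((1 + d k) / 2)) ((physTrace L β (2 * L) + twistTrace L β (2 * L)) / 2) := by
    refine ((hZ2.add hZS).div_const 2).congr_fun fun k => ?_
    ring
  have hZm_sum : HasSum (fun k => a k ^ 2 * ((1 - d k) / 2)) ((physTrace L β (2 * L) - twistTrace L β (2 * L)) / 2) := by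
    refine ((hZ2.sub hZS).div_const 2).congr_fun fun k => ?_
    ring
  have hwp0 : ∀ k, 0 ≤ (1 + d k) / 2 := fun k => by linarith [hd_ge k]
  have hwm0 : ∀ k, 0 ≤ (1 - d k) / 2 := fun k => by linarith [hd_le k]
  have hZp0 : 0 ≤ (physTrace L β (2 * L) + twistTrace L β (2 * L)) / 2 := hZp_sum.nonneg fun k => mul_nonneg (sq_nonneg _) (hwp0 k)
  have hZm0 : 0 ≤ (physTrace L β (2 * L) - twistTrace L β (2 * L)) / 2 := hZm_sum.nonneg fun k => mul_nonneg (sq_nonneg _) (hwm0 k)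
  -- a Cauchy–Schwarz step shared by `G1` and `G2`
  have hCS : ∀ (M : ℕ → ℕ → ℝ) (Rr Rc : ℕ → ℝ) (Sr Sc : ℝ),
      (∀ l, Summable (fun k => M l k ^ 2) ∧ ∑' k, M l k ^ 2 ≤ Rr l) → (∀ k, Summable (fun l => M l k ^ 2) ∧ ∑' l, M l k ^ 2 ≤ Rc k) →
      (∀ l, 0 ≤ Rr l) → (∀ k, 0 ≤ Rc k) → HasSum (fun l => a l ^ 2 * Rr l) Sr → HasSum (fun k => a k ^ 2 * Rc k) Sc →
      (∑' p : ℕ × ℕ, a p.2 * a p.1 * M p.2 p.1 ^ 2) ^ 2 ≤ Sr * Sc := by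
    intro M Rr Rc Sr Sc hrow hcol hRr0 hRc0 hSr hSc
    have hgr : Summable fun l => a l ^ 2 * ∑' k, M l k ^ 2 :=
      Summable.of_nonneg_of_le (fun l => mul_nonneg (sq_nonneg _) (tsum_nonneg fun _ => sq_nonneg _))
        (fun l => mul_le_mul_of_nonneg_left (hrow l).2 (sq_nonneg _)) hSr.summable
    have hgc : Summable fun k => a k ^ 2 * ∑' l, M l k ^ 2 :=
      Summable.of_nonneg_of_le (fun k => mul_nonneg (sq_nonneg _) (tsum_nonneg fun _ => sq_nonneg _))
        (fun k => mul_le_mul_of_nonneg_left (hcol k).2 (sq_nonneg _)) hSc.summable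
    obtain ⟨-, huH⟩ := summable_prod_of_cols (F := fun p : ℕ × ℕ => (a p.2 * |M p.2 p.1|) ^ 2) (fun p => sq_nonneg _)
      (g := fun l => a l ^ 2 * ∑' k, M l k ^ 2)
      (fun l => ((hrow l).1.hasSum.mul_left (a l ^ 2)).congr_fun fun k => by rw [mul_pow, sq_abs]) hgr
    obtain ⟨-, hvH⟩ := summable_prod_of_rows (F := fun p : ℕ × ℕ => (a p.1 * |M p.2 p.1|) ^ 2) (fun p => sq_nonneg _)
      (g := fun k => a k ^ 2 * ∑' l, M l k ^ 2)
      (fun k => ((hcol k).1.hasSum.mul_left (a k ^ 2)).congr_fun fun l => by rw [mul_pow, sq_abs]) hgc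
    have hU : ∑' l, a l ^ 2 * ∑' k, M l k ^ 2 ≤ Sr := by
      rw [← hSr.tsum_eq]; exact hgr.tsum_le_tsum (fun l => mul_le_mul_of_nonneg_left (hrow l).2 (sq_nonneg _)) hSr.summable
    have hV : ∑' k, a k ^ 2 * ∑' l, M l k ^ 2 ≤ Sc := by
      rw [← hSc.tsum_eq]; exact hgc.tsum_le_tsum (fun k => mul_le_mul_of_nonneg_left (hcol k).2 (sq_nonneg _)) hSc.summable
    obtain ⟨-, hcs⟩ := tsum_mul_sq_le (fun p => mul_nonneg (ha0 _) (abs_nonneg _)) (fun p => mul_nonneg (ha0 _) (abs_nonneg _)) huH hvH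
    have heq : ∑' p : ℕ × ℕ, a p.2 * a p.1 * M p.2 p.1 ^ 2 = ∑' p : ℕ × ℕ, (a p.2 * |M p.2 p.1|) * (a p.1 * |M p.2 p.1|) :=
      tsum_congr fun p => by
        have : M p.2 p.1 ^ 2 = |M p.2 p.1| * |M p.2 p.1| := by rw [← sq, sq_abs]
        rw [this]; ring
    rw [heq]
    have hB0 : 0 ≤ ∑' k, a k ^ 2 * ∑' l, M l k ^ 2 := tsum_nonneg fun k => mul_nonneg (sq_nonneg _) (tsum_nonneg fun _ => sq_nonneg _)
    have hSr0 : 0 ≤ Sr := hSr.nonneg fun l => mul_nonneg (sq_nonneg _) (hRr0 l)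
    exact hcs.trans (mul_le_mul hU hV hB0 hSr0)
  have hCS1 : (∑' p, G1 p) ^ 2 ≤ (physTrace L β (2 * L) + twistTrace L β (2 * L)) / 2 * ((physTrace L β (2 * L) - twistTrace L β (2 * L)) / 2) := by
    rw [hG1]; exact hCS Am _ _ _ _ hArow hAcol hwp0 hwm0 hZp_sum hZm_sum
  have hCS2 : (∑' p, G2 p) ^ 2 ≤ (physTrace L β (2 * L) - twistTrace L β (2 * L)) / 2 * ((physTrace L β (2 * L) + twistTrace L β (2 * L)) / 2) := by
    rw [hG2]; exact hCS Bm _ _ _ _ hBrow hBcol hwm0 hwp0 hZm_sum hZp_sum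
  -- conclude
  have hS1 : 0 ≤ ∑' p, G1 p := tsum_nonneg hG10
  have hS2 : 0 ≤ ∑' p, G2 p := tsum_nonneg hG20
  rw [hIeq]
  nlinarith [hCS1, hCS2, sq_nonneg (∑' p, G1 p - ∑' p, G2 p), sq_nonneg (physTrace L β (2 * L) - twistTrace L β (2 * L)),
    mul_nonneg hZp0 hZm0]

end Summit.QuantumFields.YangMills.Theorems.SwapTwistDeficit

end
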